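import Literature.Geometry.Lorentzian.LandauLifshitzComplexJet
import Summits.FinalStateConjecture.FinalStateConjecture.Theorems.EIHFluxBalanceInertialRecessionStubPseudotensorBoundMatrix
import Summits.FinalStateConjecture.FinalStateConjecture.Theorems.EIHFluxBalanceInertialRecessionStubChargeModelKSEnergy

/-!
# Route EIHFluxBalance — `InertialRecession`, line `sublinear-is-free-clean-window-charges`:
# Lipschitz dependence of LL's `h^{μνα}` and of the quasi-local momenta on the metric
# (stub `stub_identification`, part A2)

Helper file (`--supports stmt-FinalStateConjecture-10166`) for the crux
`Summit.FinalStateConjecture.FinalStateConjecture.Theses.EIHFluxBalance.InertialRecession`.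

The identification compares the charges of a small sphere about hole `j` in the LAB metric with
those of the FROZEN boosted Kerr–Schild field of hole `j`; the two differ on the sphere by the other
holes' fields, the deviation and the modulation defect. This file provides the Lipschitz estimate
that converts such `C¹`-smallness into smallness of the charges:
* `exists_norm_fderiv_superpotential_const_le`, `exists_lipschitz_fderiv_superpotential_const` —
  on the ball `‖A − η‖ ≤ 1/2` of values the value-derivative `DH^{μβνα}(A)` of the superpotential is
  bounded and Lipschitz (compactness, and the mean value inequality for the `C^∞` map `A ↦ H(A)` of
  `LandauLifshitzSuperpotentialVariation.lean`);
* `exists_abs_hField_sub_le` — **`|h[g](x) − h[G](x)| ≤ C (‖Dg(x) − DG(x)‖ + ‖g(x) − G(x)‖ ‖DG(x)‖)`**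
  for `g, G` differentiable at `x` with values within `1/2` of `η` (`h = (16π)⁻¹ Σ_β DH(g)(∂_β g)`,
  LL (96.2));
* `exists_abs_quasiLocalMomentum_sub_le` — the same for the charges of a coordinate sphere:
  `|P^μ[g] − P^μ[G]| ≤ 12πR² C (δ₁ + δ₀ b)` under pointwise bounds `δ₁, δ₀, b` on the sphere.
[cite: LandauLifshitz1975, §96 (96.2), (96.16)]
-/

set_option linter.dupNamespace false

noncomputable section

-- instance search on the nested operator spaces `E4 →L[ℝ] E4 →L[ℝ] ℝ` is deep
set_option maxSynthPendingDepth 3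

open Set Metric Filter MeasureTheory MeasureTheory.Measure Module
open scoped Topology ContDiff RealInnerProductSpace

namespace Summit.FinalStateConjecture.FinalStateConjecture.Theorems

namespace SublinearIsFree.ChargeModel

open Literature.Geometry.Lorentzian Literature.Geometry.Lorentzian.LandauLifshitz
open SublinearIsFree.PseudotensorBound

/-! ### The value-derivative of the superpotential on the ball `‖A − η‖ ≤ 1/2` -/

/-- Values within `1/2` of `η` are nondegenerate (as constant fields). [folklore] -/
theorem metricDet_const_ne_zero_of_norm_sub_le {A : E4 →L[ℝ] E4 →L[ℝ] ℝ}
    (hA : ‖A - Minkowski.bilin‖ ≤ 1 / 2) : metricDet (fun _ : E4 ↦ A) 0 ≠ 0 :=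
  metricDet_ne_zero (g := fun _ : E4 ↦ A) (x := 0) hA

/-- Membership in the closed ball of values is the norm condition. [folklore] -/
theorem mem_closedBall_minkowski_iff {A : E4 →L[ℝ] E4 →L[ℝ] ℝ} :
    A ∈ closedBall (Minkowski.bilin : E4 →L[ℝ] E4 →L[ℝ] ℝ) (1 / 2) ↔ ‖A - Minkowski.bilin‖ ≤ 1 / 2 := by
  rw [mem_closedBall, dist_eq_norm]

/-- **The value-derivative `DH^{μβνα}(A)` is bounded on the ball `‖A − η‖ ≤ 1/2`** (continuity of the
derivative of the `C^∞` value map on a compact set). [cite: LandauLifshitz1975, §96 (96.3)] -/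
theorem exists_norm_fderiv_superpotential_const_le :
    ∃ C₁ : ℝ, 0 ≤ C₁ ∧ ∀ A : E4 →L[ℝ] E4 →L[ℝ] ℝ, ‖A - Minkowski.bilin‖ ≤ 1 / 2 → ∀ μ β ν α : Fin 4,
      ‖fderiv ℝ (fun B : E4 →L[ℝ] E4 →L[ℝ] ℝ ↦ superpotential (fun _ : E4 ↦ B) 0 μ β ν α) A‖ ≤ C₁ := by
  set K : Set (E4 →L[ℝ] E4 →L[ℝ] ℝ) := closedBall Minkowski.bilin (1 / 2) with hK
  have hKc : IsCompact K := isCompact_closedBall _ _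
  have hb : ∀ μ β ν α : Fin 4, ∃ C : ℝ, ∀ A ∈ K,
      ‖fderiv ℝ (fun B : E4 →L[ℝ] E4 →L[ℝ] ℝ ↦ superpotential (fun _ : E4 ↦ B) 0 μ β ν α) A‖ ≤ C := by
    intro μ β ν α
    refine hKc.exists_bound_of_continuousOn fun A hA ↦ ?_
    have hA' : ‖A - Minkowski.bilin‖ ≤ 1 / 2 := mem_closedBall_minkowski_iff.1 hA
    exact ((contDiffAt_superpotential_const (metricDet_const_ne_zero_of_norm_sub_le hA') μ β ν α
      (n := 2)).fderiv_right (m := 1) (by norm_num)).continuousAt.continuousWithinAt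
  choose C hC using hb
  refine ⟨∑ μ, ∑ β, ∑ ν, ∑ α, |C μ β ν α|, by positivity, fun A hA μ β ν α ↦ ?_⟩
  have hA' : A ∈ K := mem_closedBall_minkowski_iff.2 hA
  calc ‖fderiv ℝ (fun B : E4 →L[ℝ] E4 →L[ℝ] ℝ ↦ superpotential (fun _ : E4 ↦ B) 0 μ β ν α) A‖
      ≤ |C μ β ν α| := (hC μ β ν α A hA').trans (le_abs_self _)
    _ ≤ ∑ α', |C μ β ν α'| := Finset.single_le_sum (f := fun α' ↦ |C μ β ν α'|)
        (fun _ _ ↦ abs_nonneg _) (Finset.mem_univ α)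
    _ ≤ ∑ ν', ∑ α', |C μ β ν' α'| := Finset.single_le_sum (f := fun ν' ↦ ∑ α', |C μ β ν' α'|)
        (fun _ _ ↦ by positivity) (Finset.mem_univ ν)
    _ ≤ ∑ β', ∑ ν', ∑ α', |C μ β' ν' α'| :=
        Finset.single_le_sum (f := fun β' ↦ ∑ ν', ∑ α', |C μ β' ν' α'|) (fun _ _ ↦ by positivity)
          (Finset.mem_univ β)
    _ ≤ ∑ μ', ∑ β', ∑ ν', ∑ α', |C μ' β' ν' α'| :=
        Finset.single_le_sum (f := fun μ' ↦ ∑ β', ∑ ν', ∑ α', |C μ' β' ν' α'|)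
          (fun _ _ ↦ by positivity) (Finset.mem_univ μ)

/-- **The value-derivative `DH^{μβνα}` is Lipschitz on the ball `‖A − η‖ ≤ 1/2`** (mean value
inequality on the convex ball, with the bound of the continuous second value-derivative on the
compact ball). [cite: LandauLifshitz1975, §96 (96.3)] -/
theorem exists_lipschitz_fderiv_superpotential_const :
    ∃ C₂ : ℝ, 0 ≤ C₂ ∧ ∀ A A' : E4 →L[ℝ] E4 →L[ℝ] ℝ, ‖A - Minkowski.bilin‖ ≤ 1 / 2 →
      ‖A' - Minkowski.bilin‖ ≤ 1 / 2 → ∀ μ β ν α : Fin 4,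
      ‖fderiv ℝ (fun B : E4 →L[ℝ] E4 →L[ℝ] ℝ ↦ superpotential (fun _ : E4 ↦ B) 0 μ β ν α) A -
        fderiv ℝ (fun B : E4 →L[ℝ] E4 →L[ℝ] ℝ ↦ superpotential (fun _ : E4 ↦ B) 0 μ β ν α) A'‖ ≤
        C₂ * ‖A - A'‖ := by
  set K : Set (E4 →L[ℝ] E4 →L[ℝ] ℝ) := closedBall Minkowski.bilin (1 / 2) with hK
  have hKc : IsCompact K := isCompact_closedBall _ _
  have hKconv : Convex ℝ K := convex_closedBall _ _
  have hb : ∀ μ β ν α : Fin 4, ∃ C : ℝ, ∀ A ∈ K, ∀ A' ∈ K,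
      ‖fderiv ℝ (fun B : E4 →L[ℝ] E4 →L[ℝ] ℝ ↦ superpotential (fun _ : E4 ↦ B) 0 μ β ν α) A -
        fderiv ℝ (fun B : E4 →L[ℝ] E4 →L[ℝ] ℝ ↦ superpotential (fun _ : E4 ↦ B) 0 μ β ν α) A'‖ ≤
        C * ‖A - A'‖ := by
    intro μ β ν α
    set F : (E4 →L[ℝ] E4 →L[ℝ] ℝ) → (E4 →L[ℝ] E4 →L[ℝ] ℝ) →L[ℝ] ℝ :=
      fderiv ℝ (fun B : E4 →L[ℝ] E4 →L[ℝ] ℝ ↦ superpotential (fun _ : E4 ↦ B) 0 μ β ν α) with hF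
    have hFs : ∀ A ∈ K, ContDiffAt ℝ 2 F A := fun A hA ↦
      (contDiffAt_superpotential_const (metricDet_const_ne_zero_of_norm_sub_le
        (mem_closedBall_minkowski_iff.1 hA)) μ β ν α (n := 3)).fderiv_right (m := 2) (by norm_num)
    obtain ⟨C, hC⟩ := hKc.exists_bound_of_continuousOn (f := fderiv ℝ F) fun A hA ↦
      ((hFs A hA).fderiv_right (m := 1) (by norm_num)).continuousAt.continuousWithinAt
    refine ⟨C, fun A hA A' hA' ↦ ?_⟩
    exact hKconv.norm_image_sub_le_of_norm_fderiv_le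
      (fun B hB ↦ (hFs B hB).differentiableAt (by simp)) hC hA' hA
  choose C hC using hb
  refine ⟨∑ μ, ∑ β, ∑ ν, ∑ α, |C μ β ν α|, by positivity, fun A A' hA hA' μ β ν α ↦ ?_⟩
  have h := hC μ β ν α A (mem_closedBall_minkowski_iff.2 hA) A' (mem_closedBall_minkowski_iff.2 hA')
  have hle : C μ β ν α ≤ ∑ μ', ∑ β', ∑ ν', ∑ α', |C μ' β' ν' α'| :=
    calc C μ β ν α ≤ |C μ β ν α| := le_abs_self _
      _ ≤ ∑ α', |C μ β ν α'| := Finset.single_le_sum (f := fun α' ↦ |C μ β ν α'|)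
          (fun _ _ ↦ abs_nonneg _) (Finset.mem_univ α)
      _ ≤ ∑ ν', ∑ α', |C μ β ν' α'| := Finset.single_le_sum (f := fun ν' ↦ ∑ α', |C μ β ν' α'|)
          (fun _ _ ↦ by positivity) (Finset.mem_univ ν)
      _ ≤ ∑ β', ∑ ν', ∑ α', |C μ β' ν' α'| :=
          Finset.single_le_sum (f := fun β' ↦ ∑ ν', ∑ α', |C μ β' ν' α'|) (fun _ _ ↦ by positivity)
            (Finset.mem_univ β)
      _ ≤ ∑ μ', ∑ β', ∑ ν', ∑ α', |C μ' β' ν' α'| :=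
          Finset.single_le_sum (f := fun μ' ↦ ∑ β', ∑ ν', ∑ α', |C μ' β' ν' α'|)
            (fun _ _ ↦ by positivity) (Finset.mem_univ μ)
  exact h.trans (mul_le_mul_of_nonneg_right hle (norm_nonneg _))

/-! ### Lipschitz dependence of `h^{μνα}` on the metric -/

/-- **`h^{μνα}` is Lipschitz in the metric and its first derivative**: there is an absolute `C` with
`|h[g](x) − h[G](x)| ≤ C (‖Dg(x) − DG(x)‖ + ‖g(x) − G(x)‖ ‖DG(x)‖)` for all fields `g, G`
differentiable at `x` with values within `1/2` of `η` there (`h = (16π)⁻¹ Σ_β DH(g)(∂_β g)`).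
[cite: LandauLifshitz1975, §96 (96.2)] -/
theorem exists_abs_hField_sub_le :
    ∃ C : ℝ, 0 ≤ C ∧ ∀ (g G : E4 → E4 →L[ℝ] E4 →L[ℝ] ℝ) (x : E4), DifferentiableAt ℝ g x →
      DifferentiableAt ℝ G x → ‖g x - Minkowski.bilin‖ ≤ 1 / 2 → ‖G x - Minkowski.bilin‖ ≤ 1 / 2 →
      ∀ μ ν α : Fin 4, |hField g x μ ν α - hField G x μ ν α| ≤
        C * (‖fderiv ℝ g x - fderiv ℝ G x‖ + ‖g x - G x‖ * ‖fderiv ℝ G x‖) := by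
  obtain ⟨C₁, hC₁, h₁⟩ := exists_norm_fderiv_superpotential_const_le
  obtain ⟨C₂, hC₂, h₂⟩ := exists_lipschitz_fderiv_superpotential_const
  refine ⟨C₁ + C₂, by positivity, fun g G x hg hG hgη hGη μ ν α ↦ ?_⟩
  have hdg : metricDet g x ≠ 0 := metricDet_ne_zero hgη
  have hdG : metricDet G x ≠ 0 := metricDet_ne_zero hGη
  set Fg : Fin 4 → (E4 →L[ℝ] E4 →L[ℝ] ℝ) →L[ℝ] ℝ := fun β ↦
    fderiv ℝ (fun B : E4 →L[ℝ] E4 →L[ℝ] ℝ ↦ superpotential (fun _ : E4 ↦ B) 0 μ β ν α) (g x) with hFg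
  set FG : Fin 4 → (E4 →L[ℝ] E4 →L[ℝ] ℝ) →L[ℝ] ℝ := fun β ↦
    fderiv ℝ (fun B : E4 →L[ℝ] E4 →L[ℝ] ℝ ↦ superpotential (fun _ : E4 ↦ B) 0 μ β ν α) (G x) with hFG
  have hh : hField g x μ ν α - hField G x μ ν α = (16 * Real.pi)⁻¹ * ∑ β : Fin 4,
      (Fg β (fderiv ℝ g x (E4.basisVector β) - fderiv ℝ G x (E4.basisVector β)) +
        (Fg β - FG β) (fderiv ℝ G x (E4.basisVector β))) := by
    rw [hField, hField, ← mul_sub, ← Finset.sum_sub_distrib]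
    congr 1
    refine Finset.sum_congr rfl fun β _ ↦ ?_
    rw [partialDeriv_superpotential_eq hg hdg, partialDeriv_superpotential_eq hG hdG, map_sub,
      _root_.sub_apply]
    ring
  have hterm : ∀ β : Fin 4, |Fg β (fderiv ℝ g x (E4.basisVector β) - fderiv ℝ G x (E4.basisVector β)) +
      (Fg β - FG β) (fderiv ℝ G x (E4.basisVector β))| ≤
      C₁ * ‖fderiv ℝ g x - fderiv ℝ G x‖ + C₂ * (‖g x - G x‖ * ‖fderiv ℝ G x‖) := by
    intro β
    have he : ‖(E4.basisVector β : E4)‖ = 1 := by simp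
    have ha : |Fg β (fderiv ℝ g x (E4.basisVector β) - fderiv ℝ G x (E4.basisVector β))| ≤
        C₁ * ‖fderiv ℝ g x - fderiv ℝ G x‖ := by
      rw [← Real.norm_eq_abs, ← _root_.sub_apply]
      refine ((Fg β).le_opNorm _).trans ?_
      refine mul_le_mul (h₁ _ hgη μ β ν α) ?_ (norm_nonneg _) hC₁
      have h := (fderiv ℝ g x - fderiv ℝ G x).le_opNorm (E4.basisVector β)
      rwa [he, mul_one] at h
    have hb : |(Fg β - FG β) (fderiv ℝ G x (E4.basisVector β))| ≤
        C₂ * (‖g x - G x‖ * ‖fderiv ℝ G x‖) := by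
      rw [← Real.norm_eq_abs]
      refine ((Fg β - FG β).le_opNorm _).trans ?_
      rw [← mul_assoc]
      refine mul_le_mul (h₂ _ _ hgη hGη μ β ν α) ?_ (norm_nonneg _) (by positivity)
      have h := (fderiv ℝ G x).le_opNorm (E4.basisVector β)
      rwa [he, mul_one] at h
    exact (abs_add_le _ _).trans (add_le_add ha hb)
  rw [hh, abs_mul, abs_inv, abs_of_pos (by positivity : (0 : ℝ) < 16 * Real.pi)]
  have hsum : |∑ β : Fin 4, (Fg β (fderiv ℝ g x (E4.basisVector β) - fderiv ℝ G x (E4.basisVector β)) +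
      (Fg β - FG β) (fderiv ℝ G x (E4.basisVector β)))| ≤
      4 * (C₁ * ‖fderiv ℝ g x - fderiv ℝ G x‖ + C₂ * (‖g x - G x‖ * ‖fderiv ℝ G x‖)) := by
    refine (Finset.abs_sum_le_sum_abs _ _).trans ?_
    calc ∑ β : Fin 4, |Fg β (fderiv ℝ g x (E4.basisVector β) - fderiv ℝ G x (E4.basisVector β)) +
          (Fg β - FG β) (fderiv ℝ G x (E4.basisVector β))|
        ≤ ∑ _β : Fin 4, (C₁ * ‖fderiv ℝ g x - fderiv ℝ G x‖ + C₂ * (‖g x - G x‖ * ‖fderiv ℝ G x‖)) :=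
          Finset.sum_le_sum fun β _ ↦ hterm β
      _ = 4 * (C₁ * ‖fderiv ℝ g x - fderiv ℝ G x‖ + C₂ * (‖g x - G x‖ * ‖fderiv ℝ G x‖)) := by
          rw [Finset.sum_const, Finset.card_univ, Fintype.card_fin]
          simp only [nsmul_eq_mul, Nat.cast_ofNat]
  have hπ : (16 * Real.pi)⁻¹ * 4 ≤ 1 := by
    rw [inv_mul_le_iff₀ (by positivity)]
    nlinarith [Real.pi_gt_three]
  have hX : 0 ≤ ‖fderiv ℝ g x - fderiv ℝ G x‖ := norm_nonneg _
  have hY : 0 ≤ ‖g x - G x‖ * ‖fderiv ℝ G x‖ := by positivity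
  calc (16 * Real.pi)⁻¹ * |∑ β : Fin 4, (Fg β (fderiv ℝ g x (E4.basisVector β) -
        fderiv ℝ G x (E4.basisVector β)) + (Fg β - FG β) (fderiv ℝ G x (E4.basisVector β)))|
      ≤ (16 * Real.pi)⁻¹ * (4 * (C₁ * ‖fderiv ℝ g x - fderiv ℝ G x‖ +
          C₂ * (‖g x - G x‖ * ‖fderiv ℝ G x‖))) :=
        mul_le_mul_of_nonneg_left hsum (by positivity)
    _ = ((16 * Real.pi)⁻¹ * 4) * (C₁ * ‖fderiv ℝ g x - fderiv ℝ G x‖ +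
          C₂ * (‖g x - G x‖ * ‖fderiv ℝ G x‖)) := by ring
    _ ≤ 1 * (C₁ * ‖fderiv ℝ g x - fderiv ℝ G x‖ + C₂ * (‖g x - G x‖ * ‖fderiv ℝ G x‖)) :=
        mul_le_mul_of_nonneg_right hπ (by positivity)
    _ ≤ (C₁ + C₂) * (‖fderiv ℝ g x - fderiv ℝ G x‖ + ‖g x - G x‖ * ‖fderiv ℝ G x‖) := by
        nlinarith [mul_nonneg hC₁ hY, mul_nonneg hC₂ hX]

/-! ### Lipschitz dependence of the quasi-local momenta on the metric -/

/-- **The quasi-local momenta are Lipschitz in the metric**: with the absolute constant `C` of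
`exists_abs_hField_sub_le`, for two fields `g, G` which on the coordinate sphere
`{(t, y) : |y − ξ| = R}` are differentiable with values within `1/2` of `η`, and satisfy there
`‖Dg − DG‖ ≤ δ₁`, `‖g − G‖ ≤ δ₀`, `‖DG‖ ≤ b`, and whose momentum densities are continuous on the
sphere, `|P^μ[g](t; ξ, R) − P^μ[G](t; ξ, R)| ≤ 12π C R² (δ₁ + δ₀ b)`.
[cite: LandauLifshitz1975, §96 (96.16)] -/
theorem exists_abs_quasiLocalMomentum_sub_le :
    ∃ C : ℝ, 0 ≤ C ∧ ∀ (g G : E4 → E4 →L[ℝ] E4 →L[ℝ] ℝ) (t : ℝ) (ξ : E3) (R δ₁ δ₀ b : ℝ), 0 < R →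
      0 ≤ δ₀ → 0 ≤ b →
      (∀ y ∈ sphere ξ R, DifferentiableAt ℝ g (E4.ofTimeSpace t y) ∧
        DifferentiableAt ℝ G (E4.ofTimeSpace t y) ∧
        ‖g (E4.ofTimeSpace t y) - Minkowski.bilin‖ ≤ 1 / 2 ∧
        ‖G (E4.ofTimeSpace t y) - Minkowski.bilin‖ ≤ 1 / 2 ∧
        ‖fderiv ℝ g (E4.ofTimeSpace t y) - fderiv ℝ G (E4.ofTimeSpace t y)‖ ≤ δ₁ ∧
        ‖g (E4.ofTimeSpace t y) - G (E4.ofTimeSpace t y)‖ ≤ δ₀ ∧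
        ‖fderiv ℝ G (E4.ofTimeSpace t y)‖ ≤ b) →
      ∀ μ : Fin 4, (∀ j : Fin 3, ContinuousOn (fun y ↦ hField g (E4.ofTimeSpace t y) μ 0 j.succ)
        (sphere ξ R)) →
      (∀ j : Fin 3, ContinuousOn (fun y ↦ hField G (E4.ofTimeSpace t y) μ 0 j.succ) (sphere ξ R)) →
      |quasiLocalMomentum g t ξ R μ - quasiLocalMomentum G t ξ R μ| ≤
        C * R ^ 2 * (δ₁ + δ₀ * b) := by
  obtain ⟨C, hC, h⟩ := exists_abs_hField_sub_le
  refine ⟨12 * Real.pi * C, by positivity, fun g G t ξ R δ₁ δ₀ b hR hδ₀ hb hpt μ hgc hGc ↦ ?_⟩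
  -- integrability of the two densities
  have hint : ∀ (f : E4 → E4 →L[ℝ] E4 →L[ℝ] ℝ),
      (∀ j : Fin 3, ContinuousOn (fun y ↦ hField f (E4.ofTimeSpace t y) μ 0 j.succ) (sphere ξ R)) →
      IntegrableOn (fun y ↦ ∑ j : Fin 3, hField f (E4.ofTimeSpace t y) μ 0 j.succ * (y - ξ) j / R)
        (sphere ξ R) (μHE[2] : Measure E3) := fun f hfc ↦
    integrableOn_sphere_of_continuousOn (continuousOn_finsetSum _ fun j _ ↦ ((hfc j).mul
      (((continuous_apply j).comp (PiLp.continuous_ofLp 2 _)).comp_continuousOn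
        (continuousOn_id.sub continuousOn_const))).div_const _)
  unfold quasiLocalMomentum
  rw [← integral_sub (hint g hgc) (hint G hGc)]
  -- pointwise bound of the difference of the densities
  have hpoint : ∀ y ∈ sphere ξ R,
      ‖(∑ j : Fin 3, hField g (E4.ofTimeSpace t y) μ 0 j.succ * (y - ξ) j / R) -
        ∑ j : Fin 3, hField G (E4.ofTimeSpace t y) μ 0 j.succ * (y - ξ) j / R‖ ≤
        3 * (C * (δ₁ + δ₀ * b)) := by
    intro y hy
    obtain ⟨hg, hG, hgη, hGη, hδ₁, hδ₀', hb'⟩ := hpt y hy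
    have hyR : ‖y - ξ‖ = R := by rwa [mem_sphere, dist_eq_norm] at hy
    rw [Real.norm_eq_abs, ← Finset.sum_sub_distrib]
    refine (Finset.abs_sum_le_sum_abs _ _).trans ?_
    calc ∑ j : Fin 3, |hField g (E4.ofTimeSpace t y) μ 0 j.succ * (y - ξ) j / R -
          hField G (E4.ofTimeSpace t y) μ 0 j.succ * (y - ξ) j / R|
        ≤ ∑ _j : Fin 3, C * (δ₁ + δ₀ * b) := by
          refine Finset.sum_le_sum fun j _ ↦ ?_
          rw [← sub_div, ← sub_mul, abs_div, abs_mul, abs_of_pos hR]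
          have h1 := h g G _ hg hG hgη hGη μ 0 j.succ
          have h2 : |(y - ξ) j| ≤ R := by
            rw [← hyR, ← Real.norm_eq_abs]
            exact PiLp.norm_apply_le (y - ξ) j
          have h3 : |hField g (E4.ofTimeSpace t y) μ 0 j.succ - hField G (E4.ofTimeSpace t y) μ 0 j.succ|
              ≤ C * (δ₁ + δ₀ * b) :=
            h1.trans (mul_le_mul_of_nonneg_left (add_le_add hδ₁
              (mul_le_mul hδ₀' hb' (norm_nonneg _) hδ₀)) hC)
          calc |hField g (E4.ofTimeSpace t y) μ 0 j.succ - hField G (E4.ofTimeSpace t y) μ 0 j.succ| *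
                |(y - ξ) j| / R ≤ C * (δ₁ + δ₀ * b) * R / R := by
                gcongr
                exact (abs_nonneg _).trans h3
            _ = C * (δ₁ + δ₀ * b) := by field_simp
      _ = 3 * (C * (δ₁ + δ₀ * b)) := by
          rw [Finset.sum_const, Finset.card_univ, Fintype.card_fin]
          simp only [nsmul_eq_mul, Nat.cast_ofNat]
  have hI := norm_setIntegral_le_of_norm_le_const (euclideanHausdorff_sphere_lt_top ξ R) hpoint
  rw [Measure.real, KSCharge.euclideanHausdorff_sphere_toReal' ξ hR, Real.norm_eq_abs] at hI
  refine hI.trans (le_of_eq ?_)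
  ring

end SublinearIsFree.ChargeModel

/-- Registered sub-goal form (stub `ll_hField_lipschitz` of the crux item) of
`SublinearIsFree.ChargeModel.exists_abs_hField_sub_le`: LL's `h^{μνα}` is Lipschitz in the metric and
its first derivative near `η`. [cite: LandauLifshitz1975, §96 (96.2)] -/
theorem ll_hField_lipschitz : open Literature.Geometry.Lorentzian in ∃ C : ℝ, 0 ≤ C ∧ ∀ (g G : E4 → E4 →L[ℝ] E4 →L[ℝ] ℝ) (x : E4), DifferentiableAt ℝ g x → DifferentiableAt ℝ G x → ‖g x - Minkowski.bilin‖ ≤ 1 / 2 → ‖G x - Minkowski.bilin‖ ≤ 1 / 2 → ∀ μ ν α : Fin 4, |LandauLifshitz.hField g x μ ν α - LandauLifshitz.hField G x μ ν α| ≤ C * (‖fderiv ℝ g x - fderiv ℝ G x‖ + ‖g x - G x‖ * ‖fderiv ℝ G x‖) :=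
  SublinearIsFree.ChargeModel.exists_abs_hField_sub_le

end Summit.FinalStateConjecture.FinalStateConjecture.Theorems

end
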